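import Mathlib
import HarnessLib

/-!
# `RationalShortRootRigidity` — Step (2d) helpers for the no-`u₃` lemma (m9), part I: the algebraic contradiction

Helper lemmas INSIDE the paper proof of crux `stmt-QuantumFields-23124` (`F4SubCurvatureDoor.RationalShortRootRigidity`,
LINE g15-A of planner ym-idea-3; Step (2d) = free-hands menu III item (m9) `Helpers.NoU3Lemma`, owner's Lean plan
HOME l15/STUB-PLAN-NoU3Lemma.md).  This part I lands the two route-independent ingredients of that plan:

* `card_roots_eq_natDegree_of_roots_real` — §0 «(W) in usable form»: a real polynomial all of whose complex roots are real
  has `card roots = natDegree` (the input format of `realRootedLimit`, p664233); induction on the degree, one real root at a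
  time (`Complex.exists_root`, `Polynomial.mul_divByMonic_eq_iff_isRoot`).
* `noU3_contradiction` — §2 «the algebraic contradiction»: for `b ≥ 2`, `a` coprime to `b`, `M ≥ 1`, `bM ≤ k` and real
  `d₀ ≠ 0, d_M ≠ 0`, the two limit polynomials `P₊(W) = Σ_{m ≤ M} d_m (−4)^{am} W^{k−bm}` and `P₋(W) = Σ d_m 4^{am} W^{k−bm}`
  cannot both have only real complex roots.  Proof: `P_ε(w) = w^{k−bM}·C_ε(w^b)` with `C_ε(T) = Σ d_m ε^{am} T^{M−m}`
  (`ε = ∓4`), `C_ε(0) = d_M ε^{aM} ≠ 0`, so every `b`-th root of every root of `C_ε` is real (`bth_roots_real`); a root exists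
  (FTA); for `b ≥ 3` multiply a real `b`-th root by `cos(2π/b) + i sin(2π/b)` (De Moivre) — non-real; for `b = 2` (`a` odd) all
  roots of `C₊` and `C₋` are positive reals while `C₊(−T) = (−1)^M C₋(T)`.

Mathlib only; THEOREMS ONLY (no definitions); no named facts; no `sorry`; default heartbeats.  Nothing about the crux 23124,
the route's rung or the Yang–Mills mass gap is proved here; (m9) itself is NOT proved by this file.  Free-hands seat
`ym-line-frs-p2` g10, `--supports stmt-QuantumFields-23124`.
-/

set_option autoImplicit false

namespace Summit.QuantumFields.YangMills.Theorems.RationalShortRootRigidity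

open Polynomial
open scoped BigOperators Polynomial

/-! ## 1. Real polynomials with only real complex roots split over `ℝ` -/

/-- A real polynomial all of whose complex roots are real has `card roots = natDegree`. [folklore] -/
theorem card_roots_eq_natDegree_of_roots_real (p : ℝ[X])
    (h : ∀ z : ℂ, Polynomial.aeval z p = 0 → z.im = 0) : Multiset.card p.roots = p.natDegree := by
  suffices H : ∀ (n : ℕ) (p : ℝ[X]), p.natDegree ≤ n → (∀ z : ℂ, Polynomial.aeval z p = 0 → z.im = 0) →
      Multiset.card p.roots = p.natDegree from H _ p le_rfl h
  intro n
  induction n with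
  | zero =>
    intro p hn _
    rw [Nat.le_zero.1 hn, eq_C_of_natDegree_eq_zero (Nat.le_zero.1 hn), roots_C, Multiset.card_zero]
  | succ n IH =>
    intro p hn h
    by_cases hdeg : p.natDegree = 0
    · rw [hdeg, eq_C_of_natDegree_eq_zero hdeg, roots_C, Multiset.card_zero]
    have hp0 : p ≠ 0 := by rintro rfl; exact hdeg natDegree_zero
    -- a complex root, which is real
    have hdegC : 0 < (p.map (algebraMap ℝ ℂ)).degree := by
      rw [degree_map_eq_of_injective (algebraMap ℝ ℂ).injective]
      exact natDegree_pos_iff_degree_pos.1 (Nat.pos_of_ne_zero hdeg)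
    obtain ⟨z, hz⟩ := Complex.exists_root hdegC
    have hz' : Polynomial.aeval z p = 0 := by rw [Polynomial.aeval_def, ← Polynomial.eval_map]; exact hz
    have hzim : z.im = 0 := h z hz'
    have hzre : z = ((z.re : ℝ) : ℂ) := by
      apply Complex.ext <;> simp [hzim]
    have hroot : p.IsRoot z.re := by
      have h1 : Polynomial.aeval ((algebraMap ℝ ℂ) z.re) p = 0 := by rw [Complex.coe_algebraMap, ← hzre]; exact hz'
      rw [aeval_algebraMap_apply_eq_algebraMap_eval, map_eq_zero_iff _ (algebraMap ℝ ℂ).injective] at h1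
      exact h1
    -- divide
    have hfac : (X - C z.re) * (p /ₘ (X - C z.re)) = p := mul_divByMonic_eq_iff_isRoot.2 hroot
    set p₁ := p /ₘ (X - C z.re) with hp₁
    have hp₁deg : p₁.natDegree = p.natDegree - 1 := by
      rw [hp₁, natDegree_divByMonic _ (monic_X_sub_C _), natDegree_X_sub_C]
    have hp₁roots : ∀ w : ℂ, Polynomial.aeval w p₁ = 0 → w.im = 0 := by
      intro w hw
      apply h
      rw [← hfac, map_mul, hw, mul_zero]
    have hcard := IH p₁ (by rw [hp₁deg]; omega) hp₁roots
    have hne : (X - C z.re) * p₁ ≠ 0 := by rw [hfac]; exact hp0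
    conv_lhs => rw [← hfac]
    rw [roots_mul hne, roots_X_sub_C, Multiset.card_add, Multiset.card_singleton, hcard, hp₁deg]
    omega

/-! ## 2. The algebraic contradiction of Step (2d) -/

/-- Every `b`-th root of every root of `C_ε(T) = Σ_{m ≤ M} d_m ε^{am} T^{M−m}` is real, provided all complex roots of
`P_ε(W) = Σ d_m ε^{am} W^{k−bm}` are real; and such roots `T` are non-zero. [folklore] -/
theorem bth_roots_real (k a b M : ℕ) (d : ℕ → ℝ) (ε : ℂ) (hε : ε ≠ 0) (hkM : b * M ≤ k) (hdM : d M ≠ 0)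
    (hP : ∀ w : ℂ, (∑ m ∈ Finset.range (M + 1), (d m : ℂ) * ε ^ (a * m) * w ^ (k - b * m)) = 0 → w.im = 0)
    (T : ℂ) (hT : (∑ m ∈ Finset.range (M + 1), (d m : ℂ) * ε ^ (a * m) * T ^ (M - m)) = 0) :
    T ≠ 0 ∧ ∀ w : ℂ, w ^ b = T → w.im = 0 := by
  constructor
  · rintro rfl
    rw [Finset.sum_eq_single M] at hT
    · rw [Nat.sub_self, pow_zero, mul_one] at hT
      exact (mul_ne_zero (Complex.ofReal_ne_zero.2 hdM) (pow_ne_zero _ hε)) hT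
    · intro m hm hmM
      have hlt : m < M := lt_of_le_of_ne (Nat.lt_succ_iff.1 (Finset.mem_range.1 hm)) hmM
      rw [zero_pow (Nat.sub_ne_zero_of_lt hlt), mul_zero]
    · intro h; exact absurd (Finset.mem_range.2 (Nat.lt_succ_self M)) h
  · intro w hw
    apply hP
    have hexp : ∀ m ∈ Finset.range (M + 1), k - b * m = (k - b * M) + b * (M - m) := by
      intro m hm
      have hmM : m ≤ M := Nat.lt_succ_iff.1 (Finset.mem_range.1 hm)
      have h1 : b * m ≤ b * M := Nat.mul_le_mul_left _ hmM
      rw [mul_tsub]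
      omega
    calc (∑ m ∈ Finset.range (M + 1), (d m : ℂ) * ε ^ (a * m) * w ^ (k - b * m))
        = w ^ (k - b * M) * ∑ m ∈ Finset.range (M + 1), (d m : ℂ) * ε ^ (a * m) * T ^ (M - m) := by
          rw [Finset.mul_sum]
          refine Finset.sum_congr rfl fun m hm => ?_
          rw [hexp m hm, pow_add, pow_mul w b (M - m), hw]
          ring
      _ = 0 := by rw [hT, mul_zero]

/-- **The algebraic contradiction of Step (2d)** (§2 of the owner's STUB-PLAN for (m9) `NoU3Lemma`): for `b ≥ 2`, `a` coprime to
`b`, `M ≥ 1`, `bM ≤ k`, `d₀ ≠ 0 ≠ d_M`, the polynomials `Σ_{m ≤ M} d_m (−4)^{am} W^{k−bm}` and `Σ_{m ≤ M} d_m 4^{am} W^{k−bm}` cannot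
both have only real complex roots. [folklore] -/
theorem noU3_contradiction (k a b M : ℕ) (d : ℕ → ℝ) (hb : 2 ≤ b) (hab : Nat.Coprime a b) (hM : 1 ≤ M)
    (hkM : b * M ≤ k) (hd0 : d 0 ≠ 0) (hdM : d M ≠ 0)
    (hplus : ∀ w : ℂ, (∑ m ∈ Finset.range (M + 1), (d m : ℂ) * (-4 : ℂ) ^ (a * m) * w ^ (k - b * m)) = 0 → w.im = 0)
    (hminus : ∀ w : ℂ, (∑ m ∈ Finset.range (M + 1), (d m : ℂ) * (4 : ℂ) ^ (a * m) * w ^ (k - b * m)) = 0 → w.im = 0) :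
    False := by
  -- the polynomials `C_ε`, `ε = ∓4`, as complex polynomials, and their roots
  have hCroot : ∀ ε : ℂ, ∃ T : ℂ, (∑ m ∈ Finset.range (M + 1), (d m : ℂ) * ε ^ (a * m) * T ^ (M - m)) = 0 := by
    intro ε
    set Cε : ℂ[X] := ∑ m ∈ Finset.range (M + 1), Polynomial.C ((d m : ℂ) * ε ^ (a * m)) * X ^ (M - m) with hCε
    have heval : ∀ T : ℂ, Cε.eval T = ∑ m ∈ Finset.range (M + 1), (d m : ℂ) * ε ^ (a * m) * T ^ (M - m) := by
      intro T
      rw [hCε, eval_finsetSum]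
      refine Finset.sum_congr rfl fun m _ => ?_
      rw [eval_mul, eval_C, eval_pow, eval_X]
    have hcoeff : Cε.coeff M = (d 0 : ℂ) := by
      rw [hCε, finsetSum_coeff, Finset.sum_eq_single 0]
      · rw [coeff_C_mul_X_pow, Nat.sub_zero, if_pos rfl, mul_zero, pow_zero, mul_one]
      · intro m hm hm0
        rw [coeff_C_mul_X_pow, if_neg]
        have : m ≤ M := Nat.lt_succ_iff.1 (Finset.mem_range.1 hm)
        omega
      · intro h; exact absurd (Finset.mem_range.2 (Nat.succ_pos M)) h
    have hdeg : 0 < Cε.degree := by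
      have h1 : (M : WithBot ℕ) ≤ Cε.degree := le_degree_of_ne_zero (by rw [hcoeff]; exact Complex.ofReal_ne_zero.2 hd0)
      exact lt_of_lt_of_le (by exact_mod_cast hM) h1
    obtain ⟨T, hT⟩ := Complex.exists_root hdeg
    exact ⟨T, by rw [← heval]; exact hT⟩
  have h4 : (4 : ℂ) ≠ 0 := by norm_num
  have hn4 : (-4 : ℂ) ≠ 0 := by norm_num
  rcases Nat.lt_or_ge 2 b with hb3 | hb2
  · -- `b ≥ 3`: a real `b`-th root times a primitive `b`-th root of unity is a non-real `b`-th root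
    obtain ⟨T₀, hT₀⟩ := hCroot (-4)
    obtain ⟨hT₀0, hreal⟩ := bth_roots_real k a b M d (-4) hn4 hkM hdM hplus T₀ hT₀
    obtain ⟨w₀, hw₀⟩ := IsAlgClosed.exists_pow_nat_eq T₀ (by omega : 0 < b)
    have hw₀im : w₀.im = 0 := hreal w₀ hw₀
    have hw₀0 : w₀ ≠ 0 := by rintro rfl; rw [zero_pow (by omega)] at hw₀; exact hT₀0 hw₀.symm
    have hw₀re : w₀.re ≠ 0 := fun h => hw₀0 (Complex.ext h hw₀im)
    set θ : ℝ := 2 * Real.pi / b with hθ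
    set ζ : ℂ := Complex.cos (θ : ℂ) + Complex.sin (θ : ℂ) * Complex.I with hζ
    have hζb : ζ ^ b = 1 := by
      rw [hζ, Complex.cos_add_sin_mul_I_pow]
      have hb0 : (b : ℂ) ≠ 0 := by exact_mod_cast (show b ≠ 0 by omega)
      have : (b : ℂ) * (θ : ℂ) = 2 * Real.pi := by
        rw [hθ]; push_cast; rw [mul_div_assoc', mul_div_cancel_left₀ _ hb0]
      rw [this, Complex.cos_two_pi, Complex.sin_two_pi, zero_mul, add_zero]
    have hsin : 0 < Real.sin θ := by
      apply Real.sin_pos_of_pos_of_lt_pi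
      · rw [hθ]; positivity
      · rw [hθ, div_lt_iff₀ (by positivity)]
        have : (3 : ℝ) ≤ b := by exact_mod_cast hb3
        nlinarith [Real.pi_pos]
    have hw₁ : (w₀ * ζ) ^ b = T₀ := by rw [mul_pow, hζb, mul_one, hw₀]
    have hw₁im : (w₀ * ζ).im = w₀.re * Real.sin θ := by
      rw [hζ, ← Complex.ofReal_cos, ← Complex.ofReal_sin]
      simp only [Complex.mul_im, Complex.add_re, Complex.add_im, Complex.mul_re, Complex.ofReal_re, Complex.ofReal_im,
        Complex.I_re, Complex.I_im, hw₀im]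
      ring
    have := hreal _ hw₁
    rw [hw₁im] at this
    exact (mul_ne_zero hw₀re hsin.ne') this
  · -- `b = 2`, `a` odd: all roots of `C₊` and `C₋` are positive reals, but `C₊(−T) = (−1)^M C₋(T)`
    have hb2' : b = 2 := le_antisymm hb2 hb
    subst hb2'
    have ha : Odd a := Nat.coprime_two_right.1 hab
    have hpos : ∀ ε : ℂ, ε ≠ 0 →
        (∀ w : ℂ, (∑ m ∈ Finset.range (M + 1), (d m : ℂ) * ε ^ (a * m) * w ^ (k - 2 * m)) = 0 → w.im = 0) →
        ∀ T : ℂ, (∑ m ∈ Finset.range (M + 1), (d m : ℂ) * ε ^ (a * m) * T ^ (M - m)) = 0 → T.im = 0 ∧ 0 < T.re := by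
      intro ε hε hP T hT
      obtain ⟨hT0, hreal⟩ := bth_roots_real k a 2 M d ε hε hkM hdM hP T hT
      obtain ⟨w, hw⟩ := IsAlgClosed.exists_pow_nat_eq T (by norm_num : 0 < 2)
      have hwim : w.im = 0 := hreal w hw
      have hw0 : w ≠ 0 := by rintro rfl; rw [zero_pow two_ne_zero] at hw; exact hT0 hw.symm
      have hwre : w.re ≠ 0 := fun h => hw0 (Complex.ext h hwim)
      rw [← hw]
      refine ⟨by simp [pow_two, Complex.mul_im, hwim], ?_⟩
      simp only [pow_two, Complex.mul_re, hwim, mul_zero, sub_zero]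
      exact mul_self_pos.2 hwre
    -- a positive real root `T₁` of `C₋` gives the negative root `−T₁` of `C₊`
    obtain ⟨T₁, hT₁⟩ := hCroot 4
    obtain ⟨hT₁im, hT₁re⟩ := hpos 4 h4 hminus T₁ hT₁
    have hrel : (∑ m ∈ Finset.range (M + 1), (d m : ℂ) * (-4 : ℂ) ^ (a * m) * (-T₁) ^ (M - m)) =
        (-1) ^ M * ∑ m ∈ Finset.range (M + 1), (d m : ℂ) * (4 : ℂ) ^ (a * m) * T₁ ^ (M - m) := by
      rw [Finset.mul_sum]
      refine Finset.sum_congr rfl fun m hm => ?_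
      have hmM : m ≤ M := Nat.lt_succ_iff.1 (Finset.mem_range.1 hm)
      have h1 : ((-4 : ℂ)) ^ (a * m) = (-1) ^ m * 4 ^ (a * m) := by
        rw [show (-4 : ℂ) = (-1) * 4 by norm_num, mul_pow, pow_mul, ha.neg_one_pow]
      have h2 : ((-1 : ℂ)) ^ m * (-1) ^ (M - m) = (-1) ^ M := by rw [← pow_add, Nat.add_sub_cancel' hmM]
      rw [h1, neg_pow T₁ (M - m)]
      calc (d m : ℂ) * ((-1) ^ m * 4 ^ (a * m)) * ((-1) ^ (M - m) * T₁ ^ (M - m))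
          = ((-1 : ℂ) ^ m * (-1) ^ (M - m)) * ((d m : ℂ) * 4 ^ (a * m) * T₁ ^ (M - m)) := by ring
        _ = (-1) ^ M * ((d m : ℂ) * 4 ^ (a * m) * T₁ ^ (M - m)) := by rw [h2]
    have hT₁' : (∑ m ∈ Finset.range (M + 1), (d m : ℂ) * (-4 : ℂ) ^ (a * m) * (-T₁) ^ (M - m)) = 0 := by
      rw [hrel, hT₁, mul_zero]
    obtain ⟨-, hre⟩ := hpos (-4) hn4 hplus (-T₁) hT₁'
    rw [Complex.neg_re] at hre
    linarith

end Summit.QuantumFields.YangMills.Theorems.RationalShortRootRigidity
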